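import Literature.NumberTheory.EllipticCurves.IwasawaAlgebraEisensteinQuotientTorsionProofs
import Mathlib.RingTheory.PowerSeries.WellKnown
import HarnessLib

/-!
# `q_m = T^m + p` divides no power series with a unit coefficient below degree `m`; the homogenised characteristic
# polynomial `Δ = ℓ² + a₁ ℓ (1+T)^N + a₀ (1+T)^{2N}` is non-zero in `S_m = Λ/(q_m)` for `m > 2N` (proofs)

`Proofs` file (theorems only; no definition, no named fact, no instance) in topic `NumberTheory/EllipticCurves`, in the
vocabulary of the tree's Iwasawa algebra `Λ = ℤ_p⟦T⟧` (`IwasawaAlgebra p = PowerSeries ℤ_[p]`) and Howard's discrete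
valuation rings `S_m = Λ/(T^m + p)` at the Eisenstein primes `𝔮 = (T^m + p)` ([Howard 2004], proof of Thm. 2.2.10).

* §1 `coeff_eq_mul_of_X_pow_add_C_mul` — if `F = (T^m + p) · G` then `coeff_k F = p · coeff_k G` for every `k < m`;
  hence **`not_X_pow_add_C_dvd_of_isUnit_coeff`**: a power series with a UNIT coefficient in some degree `k < m` is not
  divisible by `q_m`, its class in `S_m` is non-zero (`mk_ne_zero_of_isUnit_coeff`) and generates an ideal of finite
  index (`finite_quotient_span_mk_of_isUnit_coeff`, the tree's `finite_quotient_span_singleton_of_ne_zero`).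
* §2 the element **`Δ = C ℓ² + C (a₁ ℓ) · (1+T)^N + C a₀ · (1+T)^{2N}`** (the characteristic polynomial `X² + a₁X + a₀`
  of a Galois element on `T_p E`, homogenised against the twist `(1+T)^N = ψ(σ)` and evaluated at `ℓ`): its coefficient
  in degree `2N` is `a₀` (`coeff_two_mul_charTwistElement`), so for `a₀` a unit and `m > 2N` it is non-zero in `S_m`
  with `S_m/(Δ̄)` finite (`finite_quotient_span_charTwistElement`) — the `j`-INDEPENDENT annihilator behind the uniform
  bound on `H⁰(K_v, E[p^j] ⊗ A_{m,j}(ψ))` (Howard H.4 at `v ∣ N`, cell `pub/bsd-print-x9`).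

References: [Howard2004HeegnerKolyvagin] B. Howard, Compositio Math. 140 (2004), §2.2 and proof of Thm. 2.2.10
(`𝔮 = T^m + p`, `S_𝔮` a DVR); [Washington1997] L. Washington, *Introduction to Cyclotomic Fields*, §7.1 (distinguished
polynomials, division in `Λ`). BSD is not proved by any of this.
-/

noncomputable section

open PowerSeries

namespace Literature.NumberTheory.EllipticCurves

namespace IwasawaAlgebra

variable (p : ℕ) [hp : Fact p.Prime]

/-! ## §1 Unit coefficients below degree `m` obstruct divisibility by `q_m` -/

/-- **Coefficients of a multiple of `q_m` below degree `m`**: if `F = (T^m + p) · G` in `Λ` then `coeff_k F = p · coeff_k G`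
for `k < m`. [cite: Washington1997, §7.1] -/
theorem coeff_eq_mul_of_X_pow_add_C_mul (m : ℕ) (G : IwasawaAlgebra p) {k : ℕ} (hk : k < m) :
    coeff k ((X ^ m + C (p : ℤ_[p])) * G) = (p : ℤ_[p]) * coeff k G := by
  rw [add_mul, map_add, coeff_C_mul, PowerSeries.coeff_X_pow_mul', if_neg (not_le.mpr hk), zero_add]

/-- **A power series with a unit coefficient in degree `k < m` is not divisible by `q_m = T^m + p`.**
[cite: Washington1997, §7.1] -/
theorem not_X_pow_add_C_dvd_of_isUnit_coeff {m : ℕ} {F : IwasawaAlgebra p} {k : ℕ} (hk : k < m)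
    (hu : IsUnit (coeff k F)) : ¬ (X ^ m + C (p : ℤ_[p]) : IwasawaAlgebra p) ∣ F := by
  rintro ⟨G, rfl⟩
  rw [coeff_eq_mul_of_X_pow_add_C_mul p m G hk] at hu
  have hpu : IsUnit (p : ℤ_[p]) := isUnit_of_mul_isUnit_left hu
  exact PadicInt.p_nonunit hpu

/-- Hence its class in `S_m = Λ/(q_m)` is non-zero. [cite: Howard2004HeegnerKolyvagin, §2.2 (S_𝔮 = Λ/𝔮)] -/
theorem mk_ne_zero_of_isUnit_coeff {m : ℕ} {F : IwasawaAlgebra p} {k : ℕ} (hk : k < m) (hu : IsUnit (coeff k F)) :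
    Ideal.Quotient.mk (Ideal.span {(X ^ m + C (p : ℤ_[p]) : IwasawaAlgebra p)}) F ≠ 0 := by
  rw [Ne, Ideal.Quotient.eq_zero_iff_mem, Ideal.mem_span_singleton]
  exact not_X_pow_add_C_dvd_of_isUnit_coeff p hk hu

/-- And `S_m/(F̄)` is finite. [cite: Howard2004HeegnerKolyvagin, §2.2 (S_𝔮 a DVR, finite over ℤ_p)] -/
theorem finite_quotient_span_mk_of_isUnit_coeff {m : ℕ} (hm : 1 ≤ m) {F : IwasawaAlgebra p} {k : ℕ} (hk : k < m)
    (hu : IsUnit (coeff k F)) :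
    Finite ((IwasawaAlgebra p ⧸ Ideal.span {(X ^ m + C (p : ℤ_[p]) : IwasawaAlgebra p)}) ⧸
      Ideal.span {Ideal.Quotient.mk (Ideal.span {(X ^ m + C (p : ℤ_[p]) : IwasawaAlgebra p)}) F}) :=
  finite_quotient_span_singleton_of_ne_zero p hm _ (mk_ne_zero_of_isUnit_coeff p hk hu)

/-! ## §2 The homogenised characteristic polynomial `Δ` -/

/-- Coefficients of `(1 + T)^n` in `Λ`: `coeff_k (1+T)^n = n.choose k` (binomial theorem). [cite: Washington1997, §7.1 (polynomials in Λ)] -/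
theorem coeff_one_add_X_pow (n k : ℕ) :
    coeff k (((1 : IwasawaAlgebra p) + X) ^ n) = (n.choose k : ℤ_[p]) := by
  have h : ((1 : IwasawaAlgebra p) + X) ^ n = (((1 + Polynomial.X) ^ n : Polynomial ℤ_[p]) : IwasawaAlgebra p) := by
    rw [Polynomial.coe_pow, Polynomial.coe_add, Polynomial.coe_one, Polynomial.coe_X]
  rw [h, Polynomial.coeff_coe, Polynomial.coeff_one_add_X_pow]

/-- **The degree-`2N` coefficient of `Δ = C ℓ² + C (a₁ℓ) (1+T)^N + C a₀ (1+T)^{2N}` is `a₀`** (`N ≥ 1`): the first two terms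
have degree `< 2N`. [cite: Howard2004HeegnerKolyvagin, §2.2] -/
theorem coeff_two_mul_charTwistElement (a₁ a₀ ℓ : ℤ_[p]) {N : ℕ} (hN : 1 ≤ N) :
    coeff (2 * N) (C (ℓ ^ 2) + C (a₁ * ℓ) * ((1 : IwasawaAlgebra p) + X) ^ N +
      C a₀ * ((1 : IwasawaAlgebra p) + X) ^ (2 * N)) = a₀ := by
  rw [map_add, map_add, coeff_C_mul, coeff_C_mul, coeff_one_add_X_pow, coeff_one_add_X_pow, coeff_C,
    if_neg (by omega), Nat.choose_eq_zero_of_lt (by omega), Nat.choose_self]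
  simp

/-- **`Δ̄ ≠ 0` in `S_m` and `S_m/(Δ̄)` is finite for `a₀` a unit and `m > 2N ≥ 2`** — the `j`-independent annihilator of
the twisted fixed points. [cite: Howard2004HeegnerKolyvagin, §2.2 and proof of Thm. 2.2.10] -/
theorem finite_quotient_span_charTwistElement {m : ℕ} (a₁ ℓ : ℤ_[p]) {a₀ : ℤ_[p]} (ha₀ : IsUnit a₀) {N : ℕ}
    (hN : 1 ≤ N) (hmN : 2 * N < m) :
    Ideal.Quotient.mk (Ideal.span {(X ^ m + C (p : ℤ_[p]) : IwasawaAlgebra p)})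
        (C (ℓ ^ 2) + C (a₁ * ℓ) * ((1 : IwasawaAlgebra p) + X) ^ N + C a₀ * ((1 : IwasawaAlgebra p) + X) ^ (2 * N)) ≠ 0 ∧
      Finite ((IwasawaAlgebra p ⧸ Ideal.span {(X ^ m + C (p : ℤ_[p]) : IwasawaAlgebra p)}) ⧸
        Ideal.span {Ideal.Quotient.mk (Ideal.span {(X ^ m + C (p : ℤ_[p]) : IwasawaAlgebra p)})
          (C (ℓ ^ 2) + C (a₁ * ℓ) * ((1 : IwasawaAlgebra p) + X) ^ N + C a₀ * ((1 : IwasawaAlgebra p) + X) ^ (2 * N))}) := by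
  have hu : IsUnit (coeff (2 * N) (C (ℓ ^ 2) + C (a₁ * ℓ) * ((1 : IwasawaAlgebra p) + X) ^ N +
      C a₀ * ((1 : IwasawaAlgebra p) + X) ^ (2 * N))) := by
    rw [coeff_two_mul_charTwistElement p a₁ a₀ ℓ hN]; exact ha₀
  exact ⟨mk_ne_zero_of_isUnit_coeff p hmN hu, finite_quotient_span_mk_of_isUnit_coeff p (by omega) hmN hu⟩

end IwasawaAlgebra

end Literature.NumberTheory.EllipticCurves

end
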